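import Mathlib.Analysis.Convex.Combination
import Mathlib.Order.Interval.Set.Pi
import Mathlib.Data.Nat.Find
import Mathlib.Data.Fintype.Pi
import Mathlib.Data.Finset.Lattice.Fold
import Mathlib.Data.Real.Basic
import Mathlib.Data.Fin.VecNotation
import Mathlib.Algebra.BigOperators.Fin
import Mathlib.Tactic.Linarith
import Mathlib.Tactic.FieldSimp
import Literature.Computation.Certificates.SharedVaryingBoxCertificate
import HarnessLib

/-!
# A parameter box inside a finite union of certified cells carries the cells' word
# (covering / composition rule for box certificates, with the grid bookkeeping)

Topic `Literature/Computation/Certificates` (joins `SharedVaryingBoxCertificate.lean` — vertex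
certificates ⇒ a word on ONE cell — and `LagrangianSplitBound.lean`). Written for the Hubbard
material oracle (D-0096/D-0097 stage S2 "points → boxes": a downfolded parameter BOX
`Set.Icc lo hi ⊆ (κ → ℝ)` in the coordinates `(U/t, t'/t, n, …)` must receive ONE certified word;
the certifier issues words cell by cell). Everything is PROVED; no definition, no named fact, no
number, no physics.

The principle is the soundness half of every branch-and-bound / interval-subdivision scheme
(Neumaier, *Acta Numerica* 13 (2004) §12: a box is split into sub-boxes "whose union is" the box,
eq. (12.2)–(12.3); a bound certified on every sub-box is a bound on the box — the weakest of the
sub-box bounds):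

* §1 COMPOSITION (any parameter type). Cells `C j`, `j ∈ I`, each carrying a word
  `∀ θ ∈ C j, W θ (m j)` whose constant may be weakened (`W θ m → m' ≤ m → W θ m'`, e.g. a certified
  FLOOR), and a box `B` every point of which lies in some cell: then `∀ θ ∈ B, W θ (inf' m)`
  (`forall_inf'_of_forall_cells`; `…sup'…` for ceilings; `forall_of_forall_cells` for a plain
  predicate).
* §2 GRID BOOKKEEPING (the interval arithmetic a router box needs). Per coordinate `k` a finite list of
  breakpoints `g k 0, …, g k (N k)` (NO monotonicity is required — soundness only needs the two end
  inequalities); the grid cells are `Set.Icc (fun k => g k (j k)) (fun k => g k (j k + 1))`,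
  `j k < N k`. If `g k 0 ≤ lo k` and `hi k ≤ g k (N k)` for every `k` — the whole interface check between a
  delivered box and a certified atlas — then `Set.Icc lo hi ⊆ ⋃ cells` (`exists_gridCell_of_mem_Icc`,
  `Icc_subset_biUnion_gridCells`; one coordinate `exists_Icc_succ_of_mem_Icc`; two scalar coordinates
  `exists_gridCell₂_of_mem`). For cell rules stated on the convex hull of a cell's corners with
  explicit barycentric weights (the tree's `…_of_window_certificates_convexComb_TT'_ineq…` family),
  `exists_convexWeights_Icc / _rectCorners / _boxVertices` produce the weights of a point of a
  segment / rectangle / coordinate box.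
* §3 BOX WORDS FROM CELL WORDS: `forall_mem_Icc_of_forall_gridCells` (predicate),
  `le_of_forall_gridCells_certified` / `inf'_le_of_forall_gridCells_certified` (the certificate shape
  of `SharedVaryingBoxCertificate`: `∀ θ ∈ cell, ∀ y ∈ F θ ∩ D, m ≤ c y θ`),
  `mem_Icc_of_forall_gridCells_window` (two-sided windows of a function), the two-coordinate scalar
  form `le_of_forall_gridCells₂`, and the rule composed with the fixed-dual cell certificate
  `le_of_forall_gridCells_boxVertices_shared` (per cell ONE dual checked at the cell's `2^|κ|`
  vertices ⇒ the word on the whole delivered box). Nesting (a cell subdivided again) is the same rule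
  applied to the cell.
* §4 HULL FORM ⇒ POINT FORM: a cell rule stated for all convex weights on a rectangle's corners / a
  box's vertices holds at every point of the rectangle / box (`forall_mem_rect_of_forall_convexWeights`,
  `forall_mem_Icc_of_forall_convexWeights_boxVertices`), and a grid of such rules gives the box word
  (`forall_mem_of_forall_gridCells_convexWeights₂`).

What is NOT here: how a cell word is produced (vertex rules, transport, relaxations); any claim that
a covering by NON-grid cells can be checked (refine to a grid instead); monotone / Lipschitz transport
inside a cell (single-coordinate lemmas live with the energy-density region toolkit).

## Mathlib / tree search

Mathlib: `Monotone.biUnion_Ico_Ioc_map_succ` (half-open version, needs monotonicity; not used),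
`Nat.findGreatest_spec / _le / _is_greatest`, `Fintype.mem_piFinset`, `Finset.inf'_le`,
`Finset.le_sup'`, `convexHull_pi`, `convexHull_pair`, `segment_eq_Icc'`, `Finset.mem_convexHull`,
`Finset.centerMass_eq_of_sum_1`. Tree: `SharedVaryingBox.le_of_forall_boxVertices_shared[Varying]`
(one cell from its vertices), Summits-side `…Transport.BoxCertificate.Icc_subset_convexHull_boxVertices`
(not importable here; the weights form below is the statement consumers of the `convexComb` window
theorems need). `lean search 'gridCell|subset_biUnion.*Icc|convexWeights'`: nothing of this kind.

## References

* A. Neumaier, *Complete search in continuous global optimization and constraint satisfaction*,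
  Acta Numerica 13 (2004) 271–369, §12 eq. (12.2)–(12.3) (branching: sub-boxes whose union is the
  box; bounds per sub-box). [cite: Neumaier2004CompleteSearch, §12]
* R. T. Rockafellar, *Convex Analysis*, Princeton 1970, §32 Thm 32.2 (a polytope is the convex hull
  of its vertices; extrema over hulls). [cite: Rockafellar1970, Thm 32.2]
* D. P. Bertsekas, *Nonlinear Programming*, 2nd ed. 1999, Prop. 5.1.3 (weak duality, the cell rule
  composed in §3). [cite: Bertsekas1999NonlinearProgramming, Prop. 5.1.3]
-/

namespace Literature.Computation.Certificates.BoxCovering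

open Set Finset

/-! ### §1 Composition: a family of certified cells covering a box -/

/-- **Covering rule, predicate form.** If every point of `B` lies in some cell `C j`, `j ∈ I`, and
the word `W` holds at every point of every cell, it holds at every point of `B`.
[cite: Neumaier2004CompleteSearch, §12] -/
theorem forall_of_forall_cells {α ι : Type*} (I : Finset ι) (C : ι → Set α) {B : Set α}
    (hB : ∀ θ ∈ B, ∃ j ∈ I, θ ∈ C j) (W : α → Prop) (hW : ∀ j ∈ I, ∀ θ ∈ C j, W θ) :
    ∀ θ ∈ B, W θ := by
  intro θ hθ
  obtain ⟨j, hj, hθj⟩ := hB θ hθ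
  exact hW j hj θ hθj

/-- **Covering rule with certified constants, floor form.** Cells `C j` carry words
`W θ (m j)` whose constant may be WEAKENED downwards (`W θ m → m' ≤ m → W θ m'`: a certified lower
bound, a floor); a box covered by the cells carries the word with the smallest cell constant
`I.inf' m`. [cite: Neumaier2004CompleteSearch, §12] -/
theorem forall_inf'_of_forall_cells {α ι β : Type*} [SemilatticeInf β] (I : Finset ι)
    (hI : I.Nonempty) (C : ι → Set α) {B : Set α} (hB : ∀ θ ∈ B, ∃ j ∈ I, θ ∈ C j)
    (W : α → β → Prop) (hmono : ∀ θ m m', W θ m → m' ≤ m → W θ m') (m : ι → β)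
    (hW : ∀ j ∈ I, ∀ θ ∈ C j, W θ (m j)) : ∀ θ ∈ B, W θ (I.inf' hI m) := by
  intro θ hθ
  obtain ⟨j, hj, hθj⟩ := hB θ hθ
  exact hmono θ (m j) _ (hW j hj θ hθj) (Finset.inf'_le m hj)

/-- **Covering rule with certified constants, ceiling form** (`W θ m → m ≤ m' → W θ m'`: a certified
upper bound): the box carries the largest cell constant `I.sup' m`.
[cite: Neumaier2004CompleteSearch, §12] -/
theorem forall_sup'_of_forall_cells {α ι β : Type*} [SemilatticeSup β] (I : Finset ι)
    (hI : I.Nonempty) (C : ι → Set α) {B : Set α} (hB : ∀ θ ∈ B, ∃ j ∈ I, θ ∈ C j)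
    (W : α → β → Prop) (hmono : ∀ θ m m', W θ m → m ≤ m' → W θ m') (m : ι → β)
    (hW : ∀ j ∈ I, ∀ θ ∈ C j, W θ (m j)) : ∀ θ ∈ B, W θ (I.sup' hI m) := by
  intro θ hθ
  obtain ⟨j, hj, hθj⟩ := hB θ hθ
  exact hmono θ (m j) _ (hW j hj θ hθj) (Finset.le_sup' m hj)

/-- **Uniform-constant form**: if one constant `m₀` is below every cell constant (`m₀ ≤ m j`), the
box carries `W θ m₀`. [cite: Neumaier2004CompleteSearch, §12] -/
theorem forall_of_forall_cells_of_le {α ι β : Type*} [Preorder β] (I : Finset ι) (C : ι → Set α)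
    {B : Set α} (hB : ∀ θ ∈ B, ∃ j ∈ I, θ ∈ C j) (W : α → β → Prop)
    (hmono : ∀ θ m m', W θ m → m' ≤ m → W θ m') (m : ι → β) {m₀ : β} (hm₀ : ∀ j ∈ I, m₀ ≤ m j)
    (hW : ∀ j ∈ I, ∀ θ ∈ C j, W θ (m j)) : ∀ θ ∈ B, W θ m₀ := by
  intro θ hθ
  obtain ⟨j, hj, hθj⟩ := hB θ hθ
  exact hmono θ (m j) _ (hW j hj θ hθj) (hm₀ j hj)

/-! ### §2 Grid bookkeeping: a coordinate box lies in the union of the grid cells -/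

/-- **One coordinate.** Breakpoints `x 0, x 1, …, x N` of a linear order (`0 < N`; NO monotonicity
assumed) and a point with `x 0 ≤ p ≤ x N`: some consecutive pair brackets it, `x i ≤ p ≤ x (i+1)`,
`i < N` (take the last `i ≤ N - 1` with `x i ≤ p`). [cite: Neumaier2004CompleteSearch, §12] -/
theorem exists_Icc_succ_of_mem_Icc {α : Type*} [LinearOrder α] {x : ℕ → α} {N : ℕ} (hN : 0 < N)
    {p : α} (h0 : x 0 ≤ p) (hN' : p ≤ x N) : ∃ i < N, p ∈ Set.Icc (x i) (x (i + 1)) := by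
  classical
  set i := Nat.findGreatest (fun i => x i ≤ p) (N - 1) with hi
  have hiN : i ≤ N - 1 := Nat.findGreatest_le (N - 1)
  have hxi : x i ≤ p := Nat.findGreatest_spec (P := fun i => x i ≤ p) (Nat.zero_le (N - 1)) h0
  refine ⟨i, by omega, hxi, ?_⟩
  by_cases h : i + 1 ≤ N - 1
  · have hnot : ¬ x (i + 1) ≤ p :=
      Nat.findGreatest_is_greatest (P := fun i => x i ≤ p) (Nat.lt_succ_self i) h
    exact (lt_of_not_ge hnot).le
  · have e : i + 1 = N := by omega
    rw [e]
    exact hN'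

/-- **Coordinate box ⊆ union of grid cells.** Coordinates `κ` (finite); per coordinate a breakpoint
list `g k 0, …, g k (N k)`, `0 < N k` (no monotonicity needed); a box `Set.Icc lo hi ⊆ (κ → ℝ)` with
`g k 0 ≤ lo k` and `hi k ≤ g k (N k)` — the delivered box sits inside the gridded extent. Then every
point of the box lies in a grid cell `Set.Icc (fun k => g k (j k)) (fun k => g k (j k + 1))` with
`j k < N k`. [cite: Neumaier2004CompleteSearch, §12] -/
theorem exists_gridCell_of_mem_Icc {κ : Type*} (g : κ → ℕ → ℝ) (N : κ → ℕ) (hN : ∀ k, 0 < N k)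
    {lo hi : κ → ℝ} (hlo : ∀ k, g k 0 ≤ lo k) (hhi : ∀ k, hi k ≤ g k (N k))
    {θ : κ → ℝ} (hθ : θ ∈ Set.Icc lo hi) :
    ∃ j : κ → ℕ, (∀ k, j k < N k) ∧
      θ ∈ Set.Icc (fun k => g k (j k)) (fun k => g k (j k + 1)) := by
  rw [Set.mem_Icc] at hθ
  have h1 : ∀ k, ∃ i < N k, θ k ∈ Set.Icc (g k i) (g k (i + 1)) := fun k =>
    exists_Icc_succ_of_mem_Icc (hN k) ((hlo k).trans (hθ.1 k)) ((hθ.2 k).trans (hhi k))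
  choose j hj hmem using h1
  exact ⟨j, hj, fun k => (hmem k).1, fun k => (hmem k).2⟩

/-- The same covering as a set inclusion, cells indexed by the finite set
`Fintype.piFinset fun k => Finset.range (N k)` of multi-indices.
[cite: Neumaier2004CompleteSearch, §12] -/
theorem Icc_subset_biUnion_gridCells {κ : Type*} [Fintype κ] [DecidableEq κ] (g : κ → ℕ → ℝ)
    (N : κ → ℕ) (hN : ∀ k, 0 < N k) {lo hi : κ → ℝ} (hlo : ∀ k, g k 0 ≤ lo k)
    (hhi : ∀ k, hi k ≤ g k (N k)) :
    Set.Icc lo hi ⊆ ⋃ j ∈ Fintype.piFinset (fun k => Finset.range (N k)),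
      Set.Icc (fun k => g k (j k)) (fun k => g k (j k + 1)) := by
  intro θ hθ
  obtain ⟨j, hj, hmem⟩ := exists_gridCell_of_mem_Icc g N hN hlo hhi hθ
  refine Set.mem_biUnion (x := j) ?_ hmem
  exact Fintype.mem_piFinset.2 fun k => Finset.mem_range.2 (hj k)

/-- The multi-index set of a grid (multisection) with `0 < N k` cells in every coordinate is nonempty
(so `inf'` / `sup'` of the cell constants make sense). [cite: Neumaier2004CompleteSearch, §12] -/
theorem piFinset_range_nonempty {κ : Type*} [Fintype κ] [DecidableEq κ] (N : κ → ℕ)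
    (hN : ∀ k, 0 < N k) : (Fintype.piFinset fun k => Finset.range (N k)).Nonempty :=
  Fintype.piFinset_nonempty.2 fun k => ⟨0, Finset.mem_range.2 (hN k)⟩

/-- **Two scalar coordinates** (the `(t', U)` half-plane of the energy-density region toolkit):
breakpoints `s 0, …, s M` and `u 0, …, u K` (`0 < M`, `0 < K`, no monotonicity), a point with
`s 0 ≤ x ≤ s M`, `u 0 ≤ y ≤ u K`: some grid rectangle `[s i, s (i+1)] × [u j, u (j+1)]` contains it.
[cite: Neumaier2004CompleteSearch, §12] -/
theorem exists_gridCell₂_of_mem {s u : ℕ → ℝ} {M K : ℕ} (hM : 0 < M) (hK : 0 < K) {x y : ℝ}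
    (hx0 : s 0 ≤ x) (hxM : x ≤ s M) (hy0 : u 0 ≤ y) (hyK : y ≤ u K) :
    ∃ i < M, ∃ j < K, x ∈ Set.Icc (s i) (s (i + 1)) ∧ y ∈ Set.Icc (u j) (u (j + 1)) := by
  obtain ⟨i, hi, hxi⟩ := exists_Icc_succ_of_mem_Icc hM hx0 hxM
  obtain ⟨j, hj, hyj⟩ := exists_Icc_succ_of_mem_Icc hK hy0 hyK
  exact ⟨i, hi, j, hj, hxi, hyj⟩

/-- **Barycentric weights on a segment**: `a ≤ x ≤ b` ⇒ `x = λ a + μ b` with `λ, μ ≥ 0`,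
`λ + μ = 1` (explicit: `λ = (b - x)/(b - a)` if `a < b`, `λ = 1` if `a = b`).
[cite: Rockafellar1970, Thm 32.2] -/
theorem exists_convexWeights_Icc {a b x : ℝ} (ha : a ≤ x) (hb : x ≤ b) :
    ∃ l m : ℝ, 0 ≤ l ∧ 0 ≤ m ∧ l + m = 1 ∧ l * a + m * b = x := by
  rcases eq_or_lt_of_le (ha.trans hb) with hab | hab
  · refine ⟨1, 0, zero_le_one, le_rfl, by ring, ?_⟩
    have : x = a := le_antisymm (hab ▸ hb) ha
    rw [this]; ring
  · have hd : 0 < b - a := sub_pos.2 hab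
    refine ⟨(b - x) / (b - a), (x - a) / (b - a), div_nonneg (by linarith) hd.le,
      div_nonneg (by linarith) hd.le, ?_, ?_⟩
    · field_simp; ring
    · field_simp; ring

/-- **Barycentric weights on a rectangle**: a point `(x, y)` of `[s₁, s₂] × [U₁, U₂]` is a convex
combination of the four corners, with PRODUCT weights indexed by `Fin 2 × Fin 2`
(corner `(a, b)` = `(![s₁, s₂] a, ![U₁, U₂] b)`); this is the weight datum the hull-form cell rules
(`…_of_window_certificates_convexComb_TT'_ineq…`, index set `Finset.univ`) consume to be read at an
arbitrary point of a rectangular cell. [cite: Rockafellar1970, Thm 32.2] -/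
theorem exists_convexWeights_rectCorners {s₁ s₂ U₁ U₂ x y : ℝ} (hs₁ : s₁ ≤ x) (hs₂ : x ≤ s₂)
    (hU₁ : U₁ ≤ y) (hU₂ : y ≤ U₂) :
    ∃ w : Fin 2 × Fin 2 → ℝ, (∀ i, 0 ≤ w i) ∧ ∑ i, w i = 1 ∧
      ∑ i, w i * ![s₁, s₂] i.1 = x ∧ ∑ i, w i * ![U₁, U₂] i.2 = y := by
  obtain ⟨l, m, hl, hm, hlm, hx⟩ := exists_convexWeights_Icc hs₁ hs₂
  obtain ⟨l', m', hl', hm', hlm', hy⟩ := exists_convexWeights_Icc hU₁ hU₂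
  refine ⟨fun i => ![l, m] i.1 * ![l', m'] i.2, ?_, ?_, ?_, ?_⟩
  · rintro ⟨a, b⟩
    fin_cases a <;> fin_cases b <;> simp only [Matrix.cons_val_zero, Matrix.cons_val_one,
      Fin.isValue, Fin.mk_one, Fin.zero_eta] <;> positivity
  · rw [Fintype.sum_prod_type]
    simp only [Fin.sum_univ_two, Matrix.cons_val_zero, Matrix.cons_val_one]
    linear_combination (l' + m') * hlm + hlm'
  · rw [Fintype.sum_prod_type]
    simp only [Fin.sum_univ_two, Matrix.cons_val_zero, Matrix.cons_val_one]
    linear_combination (l * s₁ + m * s₂) * hlm' + hx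
  · rw [Fintype.sum_prod_type]
    simp only [Fin.sum_univ_two, Matrix.cons_val_zero, Matrix.cons_val_one]
    linear_combination (l' * U₁ + m' * U₂) * hlm + hy

/-- **Barycentric weights on a coordinate box**: every `θ ∈ Set.Icc lo hi ⊆ (κ → ℝ)` is a convex
combination `Σ_v w v • v` of the `2^|κ|` vertices `Fintype.piFinset fun k => {lo k, hi k}`
(coordinate-wise `[lo k, hi k] = conv {lo k, hi k}` and `conv (Π Sₖ) = Π conv Sₖ`).
[cite: Rockafellar1970, Thm 32.2] -/
theorem exists_convexWeights_boxVertices {κ : Type*} [Fintype κ] [DecidableEq κ] (lo hi : κ → ℝ)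
    {θ : κ → ℝ} (hθ : θ ∈ Set.Icc lo hi) :
    ∃ w : (κ → ℝ) → ℝ, (∀ v ∈ Fintype.piFinset (fun k => ({lo k, hi k} : Finset ℝ)), 0 ≤ w v) ∧
      ∑ v ∈ Fintype.piFinset (fun k => ({lo k, hi k} : Finset ℝ)), w v = 1 ∧
      ∑ v ∈ Fintype.piFinset (fun k => ({lo k, hi k} : Finset ℝ)), w v • v = θ := by
  set T := Fintype.piFinset (fun k => ({lo k, hi k} : Finset ℝ)) with hT
  have hθT : θ ∈ convexHull ℝ (T : Set (κ → ℝ)) := by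
    rw [hT, Fintype.coe_piFinset, convexHull_pi]
    simp only [Set.mem_pi, Set.mem_univ, true_implies, Finset.coe_insert, Finset.coe_singleton]
    intro k
    rw [convexHull_pair, segment_eq_Icc']
    exact ⟨le_trans (min_le_left _ _) (hθ.1 k), le_trans (hθ.2 k) (le_max_right _ _)⟩
  obtain ⟨w, hw0, hw1, hcm⟩ := Finset.mem_convexHull.1 hθT
  refine ⟨w, hw0, hw1, ?_⟩
  rw [← hcm, Finset.centerMass_eq_of_sum_1 _ _ hw1]
  rfl

/-! ### §3 Box words from cell words on a grid -/

/-- **Box word from grid-cell words, predicate form.** If the word `W` holds at every point of every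
grid cell (`j k < N k`), it holds at every point of any box `Set.Icc lo hi` inside the gridded extent
(`g k 0 ≤ lo k`, `hi k ≤ g k (N k)`). A cell that is itself subdivided is handled by the same rule
applied to the cell (nesting = adaptive refinement). [cite: Neumaier2004CompleteSearch, §12] -/
theorem forall_mem_Icc_of_forall_gridCells {κ : Type*} (g : κ → ℕ → ℝ) (N : κ → ℕ)
    (hN : ∀ k, 0 < N k) {lo hi : κ → ℝ} (hlo : ∀ k, g k 0 ≤ lo k) (hhi : ∀ k, hi k ≤ g k (N k))
    (W : (κ → ℝ) → Prop)
    (hcell : ∀ j : κ → ℕ, (∀ k, j k < N k) →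
      ∀ θ ∈ Set.Icc (fun k => g k (j k)) (fun k => g k (j k + 1)), W θ)
    {θ : κ → ℝ} (hθ : θ ∈ Set.Icc lo hi) : W θ := by
  obtain ⟨j, hj, hmem⟩ := exists_gridCell_of_mem_Icc g N hN hlo hhi hθ
  exact hcell j hj θ hmem

/-- **Box certificate from grid-cell certificates** (the certificate shape of
`SharedVaryingBoxCertificate`: feasible sets `F θ`, a-priori domain `D`, objective `c y θ`). If on
every grid cell `j` a constant `m j` is certified — `m j ≤ c y θ` for all `θ` in the cell and all
`y ∈ F θ ∩ D`, by whatever cell rule — and `m₀ ≤ m j` for every cell, then `m₀ ≤ c y θ` for every `θ` of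
a box inside the gridded extent and every `y ∈ F θ ∩ D`. [cite: Neumaier2004CompleteSearch, §12] -/
theorem le_of_forall_gridCells_certified {Y κ : Type*} (g : κ → ℕ → ℝ) (N : κ → ℕ)
    (hN : ∀ k, 0 < N k) {lo hi : κ → ℝ} (hlo : ∀ k, g k 0 ≤ lo k) (hhi : ∀ k, hi k ≤ g k (N k))
    (F : (κ → ℝ) → Set Y) (D : Set Y) (c : Y → (κ → ℝ) → ℝ) (m : (κ → ℕ) → ℝ) {m₀ : ℝ}
    (hm₀ : ∀ j : κ → ℕ, (∀ k, j k < N k) → m₀ ≤ m j)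
    (hcell : ∀ j : κ → ℕ, (∀ k, j k < N k) →
      ∀ θ ∈ Set.Icc (fun k => g k (j k)) (fun k => g k (j k + 1)), ∀ y ∈ F θ, y ∈ D → m j ≤ c y θ)
    {θ : κ → ℝ} (hθ : θ ∈ Set.Icc lo hi) {y : Y} (hyF : y ∈ F θ) (hyD : y ∈ D) : m₀ ≤ c y θ := by
  obtain ⟨j, hj, hmem⟩ := exists_gridCell_of_mem_Icc g N hN hlo hhi hθ
  exact (hm₀ j hj).trans (hcell j hj θ hmem y hyF hyD)

/-- The same with the box constant COMPUTED as the least cell constant over the multi-index set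
`Fintype.piFinset fun k => Finset.range (N k)`. [cite: Neumaier2004CompleteSearch, §12] -/
theorem inf'_le_of_forall_gridCells_certified {Y κ : Type*} [Fintype κ] [DecidableEq κ]
    (g : κ → ℕ → ℝ) (N : κ → ℕ) (hN : ∀ k, 0 < N k) {lo hi : κ → ℝ} (hlo : ∀ k, g k 0 ≤ lo k)
    (hhi : ∀ k, hi k ≤ g k (N k)) (F : (κ → ℝ) → Set Y) (D : Set Y) (c : Y → (κ → ℝ) → ℝ)
    (m : (κ → ℕ) → ℝ)
    (hcell : ∀ j ∈ Fintype.piFinset (fun k => Finset.range (N k)),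
      ∀ θ ∈ Set.Icc (fun k => g k (j k)) (fun k => g k (j k + 1)), ∀ y ∈ F θ, y ∈ D → m j ≤ c y θ)
    {θ : κ → ℝ} (hθ : θ ∈ Set.Icc lo hi) {y : Y} (hyF : y ∈ F θ) (hyD : y ∈ D) :
    (Fintype.piFinset fun k => Finset.range (N k)).inf' (piFinset_range_nonempty N hN) m ≤
      c y θ := by
  have hmem : ∀ j : κ → ℕ, (∀ k, j k < N k) →
      j ∈ Fintype.piFinset (fun k => Finset.range (N k)) :=
    fun j hj => Fintype.mem_piFinset.2 fun k => Finset.mem_range.2 (hj k)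
  exact le_of_forall_gridCells_certified g N hN hlo hhi F D c m
    (fun j hj => Finset.inf'_le m (hmem j hj)) (fun j hj => hcell j (hmem j hj)) hθ hyF hyD

/-- **Two-sided box window from grid-cell windows** for a real function `e` of the parameter (e.g. a
ground-state energy density): floors `ℓ j ≤ e θ` and ceilings `e θ ≤ r j` on every grid cell give
`ℓ₀ ≤ e θ ≤ r₀` on the delivered box whenever `ℓ₀ ≤ ℓ j` and `r j ≤ r₀` for every cell.
[cite: Neumaier2004CompleteSearch, §12] -/
theorem mem_Icc_of_forall_gridCells_window {κ : Type*} (g : κ → ℕ → ℝ) (N : κ → ℕ)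
    (hN : ∀ k, 0 < N k) {lo hi : κ → ℝ} (hlo : ∀ k, g k 0 ≤ lo k) (hhi : ∀ k, hi k ≤ g k (N k))
    (e : (κ → ℝ) → ℝ) (ℓ r : (κ → ℕ) → ℝ) {ℓ₀ r₀ : ℝ}
    (hℓ₀ : ∀ j : κ → ℕ, (∀ k, j k < N k) → ℓ₀ ≤ ℓ j) (hr₀ : ∀ j : κ → ℕ, (∀ k, j k < N k) → r j ≤ r₀)
    (hcell : ∀ j : κ → ℕ, (∀ k, j k < N k) →
      ∀ θ ∈ Set.Icc (fun k => g k (j k)) (fun k => g k (j k + 1)), ℓ j ≤ e θ ∧ e θ ≤ r j)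
    {θ : κ → ℝ} (hθ : θ ∈ Set.Icc lo hi) : e θ ∈ Set.Icc ℓ₀ r₀ := by
  obtain ⟨j, hj, hmem⟩ := exists_gridCell_of_mem_Icc g N hN hlo hhi hθ
  obtain ⟨h1, h2⟩ := hcell j hj θ hmem
  exact ⟨(hℓ₀ j hj).trans h1, h2.trans (hr₀ j hj)⟩

/-- **Two scalar coordinates, floor form** (letters of the `(t', U)` region toolkit): a real function
`e x y` with a certified floor `ℓ i j` on every grid rectangle `[s i, s (i+1)] × [u j, u (j+1)]`
(`i < M`, `j < K`) and `ℓ₀ ≤ ℓ i j` satisfies `ℓ₀ ≤ e x y` on every rectangle `[a₁, a₂] × [b₁, b₂]` with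
`s 0 ≤ a₁`, `a₂ ≤ s M`, `u 0 ≤ b₁`, `b₂ ≤ u K`. [cite: Neumaier2004CompleteSearch, §12] -/
theorem le_of_forall_gridCells₂ {s u : ℕ → ℝ} {M K : ℕ} (hM : 0 < M) (hK : 0 < K)
    {a₁ a₂ b₁ b₂ : ℝ} (ha : s 0 ≤ a₁) (ha' : a₂ ≤ s M) (hb : u 0 ≤ b₁) (hb' : b₂ ≤ u K)
    (e : ℝ → ℝ → ℝ) (ℓ : ℕ → ℕ → ℝ) {ℓ₀ : ℝ} (hℓ₀ : ∀ i < M, ∀ j < K, ℓ₀ ≤ ℓ i j)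
    (hcell : ∀ i < M, ∀ j < K, ∀ x y : ℝ, s i ≤ x → x ≤ s (i + 1) → u j ≤ y → y ≤ u (j + 1) →
      ℓ i j ≤ e x y)
    {x y : ℝ} (hx : a₁ ≤ x) (hx' : x ≤ a₂) (hy : b₁ ≤ y) (hy' : y ≤ b₂) : ℓ₀ ≤ e x y := by
  obtain ⟨i, hi, j, hj, hxi, hyj⟩ :=
    exists_gridCell₂_of_mem hM hK (ha.trans hx) (hx'.trans ha') (hb.trans hy) (hy'.trans hb')
  exact (hℓ₀ i hi j hj).trans (hcell i hi j hj x y hxi.1 hxi.2 hyj.1 hyj.2)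

/-- **Two scalar coordinates, ceiling form.** [cite: Neumaier2004CompleteSearch, §12] -/
theorem ge_of_forall_gridCells₂ {s u : ℕ → ℝ} {M K : ℕ} (hM : 0 < M) (hK : 0 < K)
    {a₁ a₂ b₁ b₂ : ℝ} (ha : s 0 ≤ a₁) (ha' : a₂ ≤ s M) (hb : u 0 ≤ b₁) (hb' : b₂ ≤ u K)
    (e : ℝ → ℝ → ℝ) (r : ℕ → ℕ → ℝ) {r₀ : ℝ} (hr₀ : ∀ i < M, ∀ j < K, r i j ≤ r₀)
    (hcell : ∀ i < M, ∀ j < K, ∀ x y : ℝ, s i ≤ x → x ≤ s (i + 1) → u j ≤ y → y ≤ u (j + 1) →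
      e x y ≤ r i j)
    {x y : ℝ} (hx : a₁ ≤ x) (hx' : x ≤ a₂) (hy : b₁ ≤ y) (hy' : y ≤ b₂) : e x y ≤ r₀ := by
  obtain ⟨i, hi, j, hj, hxi, hyj⟩ :=
    exists_gridCell₂_of_mem hM hK (ha.trans hx) (hx'.trans ha') (hb.trans hy) (hy'.trans hb')
  exact (hcell i hi j hj x y hxi.1 hxi.2 hyj.1 hyj.2).trans (hr₀ i hi j hj)

/-- **The covering rule composed with the fixed-dual cell rule** (`SharedVaryingBox.le_of_forall_boxVertices_shared`,
Bertsekas Prop. 5.1.3): on every grid cell `j` ONE dual — shared affine penalties `ψ j r y`,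
nonnegative on feasible points throughout the cell — certifies `m j` at the cell's `2^|κ|` vertices
`Fintype.piFinset fun k => {g k (j k), g k (j k + 1)}` on the a-priori domain `D`; if `m₀ ≤ m j` for
every cell then `m₀ ≤ c y θ` at every `θ` of a box inside the gridded extent, for every
`y ∈ F θ ∩ D`. (Finitely many exact vertex evaluations, one word for the delivered box.)
[cite: Bertsekas1999NonlinearProgramming, Prop. 5.1.3] -/
theorem le_of_forall_gridCells_boxVertices_shared {Y R κ : Type*} [Fintype κ] [DecidableEq κ]
    (g : κ → ℕ → ℝ) (N : κ → ℕ) (hN : ∀ k, 0 < N k) {lo hi : κ → ℝ} (hlo : ∀ k, g k 0 ≤ lo k)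
    (hhi : ∀ k, hi k ≤ g k (N k)) (F : (κ → ℝ) → Set Y) (D : Set Y)
    (c : Y → (κ → ℝ) →ᵃ[ℝ] ℝ) (Rs : Finset R) (ψ : (κ → ℕ) → R → Y → (κ → ℝ) →ᵃ[ℝ] ℝ)
    (hψpos : ∀ j : κ → ℕ, (∀ k, j k < N k) →
      ∀ θ ∈ Set.Icc (fun k => g k (j k)) (fun k => g k (j k + 1)), ∀ r ∈ Rs, ∀ y ∈ F θ,
        0 ≤ ψ j r y θ)
    (m : (κ → ℕ) → ℝ) {m₀ : ℝ} (hm₀ : ∀ j : κ → ℕ, (∀ k, j k < N k) → m₀ ≤ m j)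
    (hvert : ∀ j : κ → ℕ, (∀ k, j k < N k) →
      ∀ v ∈ Fintype.piFinset (fun k => ({g k (j k), g k (j k + 1)} : Finset ℝ)), ∀ y ∈ D,
        m j ≤ c y v - ∑ r ∈ Rs, ψ j r y v)
    {θ : κ → ℝ} (hθ : θ ∈ Set.Icc lo hi) {y : Y} (hyF : y ∈ F θ) (hyD : y ∈ D) : m₀ ≤ c y θ :=
  le_of_forall_gridCells_certified g N hN hlo hhi F D (fun y θ => c y θ) m hm₀
    (fun j hj _ hθj _ hyF hyD =>
      SharedVaryingBox.le_of_forall_boxVertices_shared (fun k => g k (j k)) (fun k => g k (j k + 1))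
        F D c Rs (ψ j) (hψpos j hj) (m j) (hvert j hj) hθj hyF hyD)
    hθ hyF hyD

/-! ### §4 Reading a hull-form cell rule at an arbitrary point of a rectangular / coordinate-box cell -/

/-- **Hull form ⇒ rectangle form.** A cell rule stated "for all convex weights on the four corners"
(conclusion about the barycentre `(Σ w·s_corner, Σ w·U_corner)`, corners indexed by `Fin 2 × Fin 2`,
`(a, b) ↦ (![s₁, s₂] a, ![U₁, U₂] b)` — the shape of the tree's window-certificate combination
theorems with index set `Finset.univ`) holds at EVERY point of the closed rectangle
`[s₁, s₂] × [U₁, U₂]`. [cite: Rockafellar1970, Thm 32.2] -/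
theorem forall_mem_rect_of_forall_convexWeights {s₁ s₂ U₁ U₂ : ℝ} (P : ℝ → ℝ → Prop)
    (h : ∀ w : Fin 2 × Fin 2 → ℝ, (∀ i, 0 ≤ w i) → ∑ i, w i = 1 →
      P (∑ i, w i * ![s₁, s₂] i.1) (∑ i, w i * ![U₁, U₂] i.2))
    {x y : ℝ} (hx₁ : s₁ ≤ x) (hx₂ : x ≤ s₂) (hy₁ : U₁ ≤ y) (hy₂ : y ≤ U₂) : P x y := by
  obtain ⟨w, hw0, hw1, hx, hy⟩ := exists_convexWeights_rectCorners hx₁ hx₂ hy₁ hy₂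
  have hP := h w hw0 hw1
  rwa [hx, hy] at hP

/-- **Hull form ⇒ coordinate-box form.** A cell rule stated "for all convex weights on the `2^|κ|`
vertices `Fintype.piFinset fun k => {lo k, hi k}`" (conclusion about the barycentre `Σ_v w v • v`)
holds at EVERY `θ ∈ Set.Icc lo hi`. [cite: Rockafellar1970, Thm 32.2] -/
theorem forall_mem_Icc_of_forall_convexWeights_boxVertices {κ : Type*} [Fintype κ] [DecidableEq κ]
    (lo hi : κ → ℝ) (P : (κ → ℝ) → Prop)
    (h : ∀ w : (κ → ℝ) → ℝ,
      (∀ v ∈ Fintype.piFinset (fun k => ({lo k, hi k} : Finset ℝ)), 0 ≤ w v) →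
      ∑ v ∈ Fintype.piFinset (fun k => ({lo k, hi k} : Finset ℝ)), w v = 1 →
      P (∑ v ∈ Fintype.piFinset (fun k => ({lo k, hi k} : Finset ℝ)), w v • v))
    {θ : κ → ℝ} (hθ : θ ∈ Set.Icc lo hi) : P θ := by
  obtain ⟨w, hw0, hw1, hθw⟩ := exists_convexWeights_boxVertices lo hi hθ
  have hP := h w hw0 hw1
  rwa [hθw] at hP

/-- **Grid of hull-form cell rules ⇒ box word** (two scalar coordinates): if on every grid rectangle
`[s i, s (i+1)] × [u j, u (j+1)]` a rule `P` is certified in hull form (for all convex weights on that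
rectangle's corners), then `P x y` at every point of a delivered box `[a₁, a₂] × [b₁, b₂]` inside the
gridded extent. [cite: Neumaier2004CompleteSearch, §12] -/
theorem forall_mem_of_forall_gridCells_convexWeights₂ {s u : ℕ → ℝ} {M K : ℕ} (hM : 0 < M)
    (hK : 0 < K) {a₁ a₂ b₁ b₂ : ℝ} (ha : s 0 ≤ a₁) (ha' : a₂ ≤ s M) (hb : u 0 ≤ b₁) (hb' : b₂ ≤ u K)
    (P : ℝ → ℝ → Prop)
    (hcell : ∀ i < M, ∀ j < K, ∀ w : Fin 2 × Fin 2 → ℝ, (∀ l, 0 ≤ w l) → ∑ l, w l = 1 →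
      P (∑ l, w l * ![s i, s (i + 1)] l.1) (∑ l, w l * ![u j, u (j + 1)] l.2))
    {x y : ℝ} (hx : a₁ ≤ x) (hx' : x ≤ a₂) (hy : b₁ ≤ y) (hy' : y ≤ b₂) : P x y := by
  obtain ⟨i, hi, j, hj, hxi, hyj⟩ :=
    exists_gridCell₂_of_mem hM hK (ha.trans hx) (hx'.trans ha') (hb.trans hy) (hy'.trans hb')
  exact forall_mem_rect_of_forall_convexWeights P (hcell i hi j hj) hxi.1 hxi.2 hyj.1 hyj.2

end Literature.Computation.Certificates.BoxCovering
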